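import Literature.MathematicalPhysics.QuantumFieldTheory.Balaban1983to89.Beta.RemainderChartOriginDerivative
import Literature.MathematicalPhysics.QuantumFieldTheory.Balaban1983to89.Beta.RemainderDecay190TwoGridHk

/-!
# [Balaban1987RG1] p. 282 ⟵ [Balaban1985Variational] Prop. 9 AT THE ORIGIN, FLAT BACKGROUND: NODE D's socket `Data190`
# inhabited by the ACTUAL derivative `(δ/δB)𝓗(0)`, which IS Bałaban's flat `H_k` — NO LETTER (`Beta.RemainderDecay190TwoGridOriginHk`)

HONEST FRAMING (cell rule, page 1 of everything).  Discharging `BetaPertH` makes Bałaban's UV stability UNCONDITIONAL —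
a real constructive-QFT result; it is NOT the continuum limit and NOT the Clay problem.  This module discharges NOTHING of
`BetaPertH`.  It is the JUNCTION of `Beta.RemainderChartOriginDerivative.fderiv_chartH179_zero_of_flat` (at `B = 0` and
`Δ⁽²⁾H₀ = 0` the (179) chart's derivative IS `H₀`, for every Sect.-G scheme in r08's regime with a second-order Sect. C map)
with generation 101's hypothesis-free instance of NODE D by Bałaban's flat linearized minimizer `H_k = B5Hk163Torus.HkOp`
(`RemainderDecay190TwoGridHk.exists_data190_twoGrid_HkOp` ∕ `exists_consts190_twoGrid_HkOp`).  Result: on the two-grid carrier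
(coarse 1-forms → fine 1-forms, mesh `1∕nm`), NODE D's socket is inhabited by the ACTUAL derivative at the origin of every
scheme `(G̃, (δ/δA′)V, Tm = 1 − HD)` erected on `H₀ := H_k`, `Δ⁽²⁾ := 0`, with ONE explicit constant record — no decay letter assumed.

CITATION HEADER (lean-in-tree rule 2026-08-18).  [15] = [Balaban1985Variational], Commun. Math. Phys. **102** (1985) 277–309
(held `paper:balaban1985-cmp102-variational-background`; journal page = PDF page + 276): (80) p. 290, p. 289, (179)–(180) p. 306,
(182)–(184) p. 307, (190) p. 308, Prop. 9 p. 309; [I] = [Balaban1987RG1] p. 282, (4.35) p. 290, (5.10) p. 293; [B5] =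
[Balaban1984PropagatorsI] (1.59)–(1.63) pp. 27–28; [3] = [Balaban1984PropagatorsII] Cor. 2.8 (2.151) p. 249, Lemma 2.1 (2.61)
p. 234.  Read by generation 103 of this unit (text layer) and generations 12 ∕ 101 (renders named in `RemainderDecay190TwoGrid`).

## What is PROVED here (kernel-checked; 0 sorry; no `def`)

(K1) **`exists_data190_twoGrid_origin_HkOp`** — with `H₀ := H_k` (as a continuous linear map) and `Δ⁽²⁾ := 0`, for EVERY
scheme (`𝒢 n`, `W n` in a `Regime` with `0 < j n`, `0 < a n`, `hWa`; a Sect. C map `Tm n` tangent to `id` at `0`), under generation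
101's numerics: `∃ 𝒟 : Data190 D M N (fun n => T_η × Fin D → ℂ) q` whose operator IS the actual derivative `D𝓗_n(0)` — because
`D𝓗_n(0) = H_k`.  (K2) **`exists_consts190_twoGrid_origin_HkOp`** — ONE record `q⋆(D, M)` with `q⋆.Valid (rateH(D)∕D∕(4M))`
for every mesh, volume sequence, direction AND scheme.

## What is NOT claimed

* The scheme data are NOT Bałaban's constructed objects: the existence of a regime for his `V` (80) on this carrier and the
  second order of his `D` are CARRIED; here they affect only the well-definedness of the chart, not the bound.  `Δ⁽²⁾ = 0`
  is the flat-background reading of (143)/(180) with [B9] (3.137).  NODE E for this operator = `RemainderDecay190TwoGridHkLimit`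
  (the operator IS `H_k`).  No `Literature` fact is minted; no `axiom`, no `sorry`.  NOT summit progress, NOT continuum, NOT Clay.
-/

namespace Literature.MathematicalPhysics.QuantumFieldTheory.Balaban1983to89.Beta.RemainderDecay190TwoGridOriginHk

open Literature.MathematicalPhysics.QuantumFieldTheory.Balaban1983to89 B11SectG
open Literature.MathematicalPhysics.QuantumFieldTheory.Balaban1983to89.TreeLengthTorus (TPt TDom)
open Literature.MathematicalPhysics.QuantumFieldTheory.Balaban1983to89.B12Decay510Window (K₁)
open Literature.MathematicalPhysics.QuantumFieldTheory.Balaban1983to89.B12Decay510Torus (tcubeOf)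
open Literature.MathematicalPhysics.QuantumFieldTheory.Balaban1983to89.B11Eq174Chart (Regime)
open Literature.MathematicalPhysics.QuantumFieldTheory.Balaban1983to89.B11Eq183Differentiation (chartH179)
open Literature.MathematicalPhysics.QuantumFieldTheory.Balaban1983to89.B5Prop11Plancherel (Tor fine)
open Literature.MathematicalPhysics.QuantumFieldTheory.Balaban1983to89.B5Hk163Torus (HkOp)
open Literature.MathematicalPhysics.QuantumFieldTheory.Balaban1983to89.B6MainResultsOneLevel (CH0 rateH)
open Literature.MathematicalPhysics.QuantumFieldTheory.Balaban1983to89.Beta.RemainderDecay190 (Data190 Consts190)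
open Literature.MathematicalPhysics.QuantumFieldTheory.Balaban1983to89.Beta.RemainderDecay190TwoGridHk
  (exists_data190_twoGrid_HkOp exists_consts190_twoGrid_HkOp)
open Literature.MathematicalPhysics.QuantumFieldTheory.Balaban1983to89.Beta.RemainderChartOriginDerivative
  (fderiv_chartH179_zero_of_tangent_flat)

noncomputable section

/-! ## Flat background: NODE D by the actual derivative, which IS Bałaban's `H_k` — no letter -/
section Flat

variable {d : ℕ} {Mc : ℕ} [NeZero Mc] {N : ℕ → ℕ} [∀ n, NeZero (N n)]

/-- **NODE D's SOCKET INHABITED BY THE ACTUAL DERIVATIVE AT THE ORIGIN, FLAT BACKGROUND — NO LETTER.**  On the two-grid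
carrier of `RemainderDecay190TwoGridHk` (B-data = coarse 1-forms `T₁ × Fin D → ℂ`, configurations = fine 1-forms
`T_η × Fin D → ℂ`, mesh `1∕nm`, δ sources `δ_{(y,μ₀)}`), take `H₀ := H_k` (Bałaban's flat linearized minimizer
`B5Hk163Torus.HkOp` as a continuous linear map) and `Δ⁽²⁾ := 0` (flat background), and ANY Sect.-G scheme data on top
(`𝒢 n`, `W n` in a `Regime` with `0 < j n`, `0 < a n`, `hWa`; a Sect. C map `Tm n` tangent to `id` at `0`).  Under generation 101's
NUMERICS (`0 < q.σ`, `c₀(q.σ∕δr)^D ≤ q.cR`, `1 ≤ q.κB`, `q.δ15 ≤ 4·rateH(D)∕D`, `CH0(D)·D·K₁(D, rateH(D)∕(2D)) ≤ q.Cst`,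
`1 ≤ q.m`, `0 ≤ q.θ`, `q.θ·M ≤ 1`): `∃ 𝒟 : Data190 D M N (fun n => T_η × Fin D → ℂ) q` with
`𝒟.hn n X̄ y = (p ↦ cube(blockOf p.1) ∈ X̄ ? (D𝓗_n(0) δ_{(y,μ₀)})(p) : 0)` — BECAUSE `D𝓗_n(0) = H_k`
(`RemainderChartOriginDerivative.fderiv_chartH179_zero_of_flat`) and the `H_k` instance is hypothesis-free.
[cite: Balaban1985Variational, (179)-(184) pp.306-307, (190) p.308, Prop. 9 p.309; Balaban1987RG1, p.282, (4.35) p.290; Balaban1984PropagatorsI, (1.63) p.28; Balaban1984PropagatorsII, Cor. 2.8 (2.151) p.249] -/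
theorem exists_data190_twoGrid_origin_HkOp (I : Type) (i₀ : I) (η L Mg R : ℕ → ℝ) (Hh : ℕ → Prop)
    (nm : ℕ) [NeZero nm] (μ₀ : Fin (d + 1))
    (𝒵 : ℕ → Type) [∀ n, NormedAddCommGroup (𝒵 n)] [∀ n, NormedSpace ℂ (𝒵 n)] [∀ n, CompleteSpace (𝒵 n)]
    (𝒢 : (n : ℕ) → 𝒵 n →L[ℂ] (Tor (fine nm (fun _ : Fin (d + 1) => N n * Mc)) × Fin (d + 1) → ℂ))
    (W : (n : ℕ) → (Tor (fine nm (fun _ : Fin (d + 1) => N n * Mc)) × Fin (d + 1) → ℂ) → 𝒵 n)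
    (Tm : (n : ℕ) → (Tor (fine nm (fun _ : Fin (d + 1) => N n * Mc)) × Fin (d + 1) → ℂ) →
      (Tor (fine nm (fun _ : Fin (d + 1) => N n * Mc)) × Fin (d + 1) → ℂ))
    {B₀ θ C₄ a₃ j a ε₄ : ℕ → ℝ}
    (Rg : ∀ n, Regime (𝒢 n) 0 (W n) (B₀ n) (θ n) (C₄ n) (a₃ n) (j n) (a n) (ε₄ n))
    (hWa : ∀ n, AnalyticOnNhd ℂ (W n)
      {Y : Tor (fine nm (fun _ : Fin (d + 1) => N n * Mc)) × Fin (d + 1) → ℂ | ‖Y‖ < a₃ n})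
    (hj : ∀ n, 0 < j n) (ha : ∀ n, 0 < a n)
    (hTm : ∀ n, HasFDerivAt (Tm n)
      (ContinuousLinearMap.id ℂ (Tor (fine nm (fun _ : Fin (d + 1) => N n * Mc)) × Fin (d + 1) → ℂ)) 0)
    {q : Consts190} {δr : ℝ}
    (hδr : 0 < δr) (hσ₀ : 0 < q.σ) (hcR : B6.c0 δr (q.σ / δr) ^ (d + 1) ≤ q.cR) (hκB : 1 ≤ q.κB)
    (hδ15 : q.δ15 ≤ 4 * (rateH (d + 1) / ((d : ℝ) + 1)))
    (hCst : CH0 (d + 1) * ((d + 1 : ℕ) : ℝ) * K₁ (d + 1) (rateH (d + 1) / ((d : ℝ) + 1) / 2) ≤ q.Cst)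
    (hm1 : 1 ≤ q.m) (hθ : 0 ≤ q.θ) (hθM : q.θ * Mc ≤ 1) :
    ∃ 𝒟 : Data190 (d + 1) Mc N (fun n => Tor (fine nm (fun _ : Fin (d + 1) => N n * Mc)) × Fin (d + 1) → ℂ) q,
      ∀ (n : ℕ) (X : TDom (d + 1) (N n)) (y : TPt (d + 1) (N n * Mc)),
        𝒟.hn n X y = fun p : Tor (fine nm (fun _ : Fin (d + 1) => N n * Mc)) × Fin (d + 1) =>
          if tcubeOf (N n) Mc (B5Blocks16.blockOf nm (fun _ : Fin (d + 1) => N n * Mc) p.1) ∈ X.1 then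
            (fderiv ℂ (chartH179 (𝒢 n) (W n) (0 : _ →L[ℂ] 𝒵 n)
              (LinearMap.toContinuousLinearMap (HkOp nm (fun _ : Fin (d + 1) => N n * Mc)).mulVecLin)
              (Tm n) (ε₄ n)) 0 (Pi.single (y, μ₀) (1 : ℂ))) p
          else 0 := by
  obtain ⟨𝒟, h𝒟⟩ := exists_data190_twoGrid_HkOp I i₀ η L Mg R Hh nm μ₀ (N := N) hδr hσ₀ hcR hκB hδ15 hCst hm1 hθ hθM
  refine ⟨𝒟, fun n X y => ?_⟩
  rw [h𝒟 n X y]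
  have hflat := fderiv_chartH179_zero_of_tangent_flat (Rg n) (hWa n) (hj n) (ha n) (hTm n)
    (D2 := (0 : _ →L[ℂ] 𝒵 n))
    (H₀ := LinearMap.toContinuousLinearMap (HkOp nm (fun _ : Fin (d + 1) => N n * Mc)).mulVecLin)
    (ContinuousLinearMap.zero_comp _)
  rw [hflat]
  rfl

/-- **ONE CONSTANT RECORD FOR ALL STEPS, VOLUMES AND SCHEMES**: generation 101's explicit `q⋆(D, M)` with
`q⋆.Valid (rateH(D)∕D∕(4M))` serves NODE D's socket for the ACTUAL derivative at the origin of EVERY Sect.-G scheme erected on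
the flat `H_k` (every mesh `nm`, volume sequence `N`, direction `μ₀`, every `𝒢, W, Tm` as above).
[cite: Balaban1987RG1, p.282, (5.10) p.293; Balaban1985Variational, (182) p.307, (190) p.308; Balaban1984PropagatorsII, Cor. 2.8 (2.151) p.249] -/
theorem exists_consts190_twoGrid_origin_HkOp (d Mc : ℕ) [NeZero Mc] :
    ∃ q : Consts190, q.Valid (rateH (d + 1) / ((d : ℝ) + 1) / (4 * Mc)) ∧
      ∀ (I : Type) (_ : I) (η L Mg R : ℕ → ℝ) (Hh : ℕ → Prop) (N : ℕ → ℕ) [∀ n, NeZero (N n)]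
        (nm : ℕ) [NeZero nm] (μ₀ : Fin (d + 1))
        (𝒵 : ℕ → Type) [∀ n, NormedAddCommGroup (𝒵 n)] [∀ n, NormedSpace ℂ (𝒵 n)] [∀ n, CompleteSpace (𝒵 n)]
        (𝒢 : (n : ℕ) → 𝒵 n →L[ℂ] (Tor (fine nm (fun _ : Fin (d + 1) => N n * Mc)) × Fin (d + 1) → ℂ))
        (W : (n : ℕ) → (Tor (fine nm (fun _ : Fin (d + 1) => N n * Mc)) × Fin (d + 1) → ℂ) → 𝒵 n)
        (Tm : (n : ℕ) → (Tor (fine nm (fun _ : Fin (d + 1) => N n * Mc)) × Fin (d + 1) → ℂ) →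
          (Tor (fine nm (fun _ : Fin (d + 1) => N n * Mc)) × Fin (d + 1) → ℂ))
        (B₀ θ C₄ a₃ j a ε₄ : ℕ → ℝ),
        (∀ n, Regime (𝒢 n) 0 (W n) (B₀ n) (θ n) (C₄ n) (a₃ n) (j n) (a n) (ε₄ n)) →
        (∀ n, AnalyticOnNhd ℂ (W n)
          {Y : Tor (fine nm (fun _ : Fin (d + 1) => N n * Mc)) × Fin (d + 1) → ℂ | ‖Y‖ < a₃ n}) →
        (∀ n, 0 < j n) → (∀ n, 0 < a n) →
        (∀ n, HasFDerivAt (Tm n)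
          (ContinuousLinearMap.id ℂ (Tor (fine nm (fun _ : Fin (d + 1) => N n * Mc)) × Fin (d + 1) → ℂ)) 0) →
        ∃ 𝒟 : Data190 (d + 1) Mc N (fun n => Tor (fine nm (fun _ : Fin (d + 1) => N n * Mc)) × Fin (d + 1) → ℂ) q,
          ∀ (n : ℕ) (X : TDom (d + 1) (N n)) (y : TPt (d + 1) (N n * Mc)),
            𝒟.hn n X y = fun p : Tor (fine nm (fun _ : Fin (d + 1) => N n * Mc)) × Fin (d + 1) =>
              if tcubeOf (N n) Mc (B5Blocks16.blockOf nm (fun _ : Fin (d + 1) => N n * Mc) p.1) ∈ X.1 then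
                (fderiv ℂ (chartH179 (𝒢 n) (W n) (0 : _ →L[ℂ] 𝒵 n)
                  (LinearMap.toContinuousLinearMap (HkOp nm (fun _ : Fin (d + 1) => N n * Mc)).mulVecLin)
                  (Tm n) (ε₄ n)) 0 (Pi.single (y, μ₀) (1 : ℂ))) p
              else 0 := by
  obtain ⟨q, hq, hall⟩ := exists_consts190_twoGrid_HkOp d Mc
  refine ⟨q, hq, fun I i₀ η L Mg R Hh N _ nm _ μ₀ 𝒵 _ _ _ 𝒢 W Tm B₀ θ C₄ a₃ j a ε₄ Rg hWa hj ha hTm => ?_⟩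
  obtain ⟨𝒟, h𝒟⟩ := hall I i₀ η L Mg R Hh N nm μ₀
  refine ⟨𝒟, fun n X y => ?_⟩
  rw [h𝒟 n X y]
  have hflat := fderiv_chartH179_zero_of_tangent_flat (Rg n) (hWa n) (hj n) (ha n) (hTm n)
    (D2 := (0 : _ →L[ℂ] 𝒵 n))
    (H₀ := LinearMap.toContinuousLinearMap (HkOp nm (fun _ : Fin (d + 1) => N n * Mc)).mulVecLin)
    (ContinuousLinearMap.zero_comp _)
  rw [hflat]
  rfl
end Flat

end

end Literature.MathematicalPhysics.QuantumFieldTheory.Balaban1983to89.Beta.RemainderDecay190TwoGridOriginHk
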